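import Mathlib.Analysis.Calculus.FDeriv.Symmetric
import Literature.Analysis.Calculus.BCHProductLowOrder
import Literature.MathematicalPhysics.QuantumFieldTheory.Balaban1983to89.B7TransferAnalyticMean
import HarnessLib

/-!
# (q-gauge) SUPPLIER, S1-SPEC (2) — F1: **THE SECOND FRÉCHET DERIVATIVE OF THE MERCATOR LOGARITHM AT THE IDENTITY**,
# `D²log(1)[X, W] = −½(XW + WX)` in a complete normed `ℂ`-algebra, and its reading along curves

Cell `ym3-torus` (HUMAN RULING D-0037, YM ladder rung R3 — SU(2) YM₃ on T³: NOT d = 4, NOT infinite volume, NOT a mass gap, NOT Clay).  Width seat `ym3-torus-px19` (gen 15);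
the one analytic letter the LOCATE of S1-SPEC (2) (the pointwise second-order gauge-covariance identity `h2` of ✓`Prop7AvgHessGaugeIdentityNormReading`) found missing from the tree.
THEOREMS ONLY (0 `def`, 0 `sorry`, default heartbeats); `--supports stmt-QuantumFields-19200 --as helper`; count-neutral; NO claim on crux ∕ stub ∕ registry.

THE MATHEMATICS.  `log X = Σ_{n≥1} (−1)^{n+1}(X − 1)ⁿ/n` ([Balaban1985Averaging] (21) p.21; tree `MatrixLog.mlog`) is analytic on `‖X − 1‖ < 1` (✓`analyticAt_mlog`), so `D(Dlog)(1) =: B₀` exists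
(`AnalyticAt.fderiv`) and is SYMMETRIC (`ContDiffAt.isSymmSndFDerivAt_of_omega`).  Along the one-parameter group, `log(e^{uX}) = uX` for small `u` (✓`BCH.logOnePlus_exp_sub_one`); differentiating
once gives `Dlog(e^{uX})[e^{uX}X] = X`, and once more at `u = 0` (`HasDerivAt.clm_apply`, `Dlog(1) = 1` ✓`B7TransferAnalyticMean.hasFDerivAt_mlog_one`) gives the diagonal `B₀[X, X] = −X²` (also readable off the series:
✓`B7AveragingCommutator.fderiv_fderiv_mlog_one_apply_self` in the T⁴ spine, whose module is not importable on the farm today — hence the self-contained `clm_apply` route here);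
polarization gives **`B₀[X, W] = −½(XW + WX)`** — the second Taylor coefficient of (21) read as a derivative.  §3 reads it along (complex-parameter) curves through `1`, which is the form the
second-order identity (2) consumes on both of its sides (chart side through `V(A₀) = Dlog(e^{A₀})[N e^{A₀} − e^{A₀}M]`, tower side through `Dlog(U̿^{twS}(sY)(c))`).

WHAT IS PROVED (generic complete normed `ℂ`-algebra `𝔸`; namespace `…Theorems.Prop7MlogSecondDerivative`).
* §1 `fderiv_mlog_one` (`Dlog(1) = 1`), `eventually_mlog_exp_smul` (`log e^{uX} = uX` near `u = 0`), `eventually_norm_exp_smul_sub_one_lt`, ★`eventually_fderiv_mlog_exp_smul_apply`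
  (`Dlog(e^{uX})[e^{uX}X] = X` near `u = 0`).
* §2 ★`fderiv_fderiv_mlog_one_apply_self_add` (`B₀[X,X] + X² = 0`; cf. the power-series reading ✓`B7AveragingCommutator.fderiv_fderiv_mlog_one_apply_self` in the T⁴ spine), ★★★`fderiv_fderiv_mlog_one_apply` (`B₀[X,W] = −2⁻¹•(XW + WX)`), `sndDeriv_apply`, ★★★`hasFDerivAt_fderiv_mlog_one`
  (`HasFDerivAt (fderiv ℂ log) (−2⁻¹•(mul + mul.flip)) 1`).
* §3 ★`hasDerivAt_fderiv_mlog_comp` (curves through `1`: `d∕du|_{u₀} Dlog(γ u) = −2⁻¹•(mul X + mul.flip X)`), ★★`hasDerivAt_fderiv_mlog_comp_apply`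
  (`d∕du|_{u₀} Dlog(γ u)[w u] = −2⁻¹(X·w₀ + w₀·X) + w′`).
HONEST SCOPE.  Elementary calculus of the logarithmic series; nothing of (2), FR₂-lite, `hqG`, norm_G, EX, the crux or rung R3 is proved here; the Yang–Mills mass gap is NOT proved.

References: T. Bałaban, CMP **98** (1985) 17–51 [Balaban1985Averaging] ((21) p.21, (26)–(27) p.22); W. Rossmann, *Lie Groups* (2002) §1.3 [Rossmann2002].
-/

set_option autoImplicit false

noncomputable section

open scoped Topology
open Filter NormedSpace

namespace Summit.QuantumFields.YangMills.Theorems.Prop7MlogSecondDerivative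

open Literature.MathematicalPhysics.QuantumFieldTheory.Balaban1983to89
open MatrixLog (mlog mlog_def mlog_one analyticAt_mlog)
open B7TransferAnalyticMean (hasFDerivAt_mlog_one)
open Literature.Analysis.Calculus.BCH (logOnePlus_exp_sub_one)

variable {𝔸 : Type*} [NormedRing 𝔸] [NormedAlgebra ℂ 𝔸] [CompleteSpace 𝔸]

/-! ## §1 First-order letters along the one-parameter group -/

/-- `Dlog(1) = 1`. [cite: Balaban1985Averaging, (21) p.21] -/
theorem fderiv_mlog_one : fderiv ℂ (mlog : 𝔸 → 𝔸) 1 = (1 : 𝔸 →L[ℂ] 𝔸) :=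
  (hasFDerivAt_mlog_one (𝔄 := 𝔸)).fderiv

/-- `log(e^{uX}) = uX` for `u` near `0` (`‖uX‖ < log 2`). [cite: Rossmann2002, §1.3] -/
theorem eventually_mlog_exp_smul (X : 𝔸) : ∀ᶠ u : ℂ in 𝓝 0, mlog (exp (u • X)) = u • X := by
  have hc : Continuous fun u : ℂ => u • X := continuous_id.smul continuous_const
  have ht : Tendsto (fun u : ℂ => u • X) (𝓝 0) (𝓝 0) := by
    have h := hc.continuousAt (x := (0 : ℂ))
    rwa [ContinuousAt, zero_smul] at h
  have hball : Metric.ball (0 : 𝔸) (Real.log 2) ∈ 𝓝 (0 : 𝔸) := Metric.ball_mem_nhds 0 (Real.log_pos one_lt_two)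
  filter_upwards [ht hball] with u hu
  rw [Set.mem_preimage, Metric.mem_ball, dist_zero_right] at hu
  rw [mlog_def, logOnePlus_exp_sub_one hu]

/-- `‖e^{uX} − 1‖ < 1` for `u` near `0`. [folklore] -/
theorem eventually_norm_exp_smul_sub_one_lt (X : 𝔸) : ∀ᶠ u : ℂ in 𝓝 0, ‖exp (u • X) - (1 : 𝔸)‖ < 1 := by
  have hd : ∀ u : ℂ, HasDerivAt (fun v : ℂ => exp (v • X)) (exp (u • X) * X) u := fun u => hasDerivAt_exp_smul_const (𝕂 := ℂ) X u
  have hc : Continuous fun u : ℂ => exp (u • X) := continuous_iff_continuousAt.2 fun u => (hd u).continuousAt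
  have ht : Tendsto (fun u : ℂ => exp (u • X)) (𝓝 0) (𝓝 1) := by
    have h := hc.continuousAt (x := (0 : ℂ))
    rwa [ContinuousAt, zero_smul, exp_zero] at h
  have hball : Metric.ball (1 : 𝔸) 1 ∈ 𝓝 (1 : 𝔸) := Metric.ball_mem_nhds 1 one_pos
  filter_upwards [ht hball] with u hu
  rwa [Set.mem_preimage, Metric.mem_ball, dist_eq_norm] at hu

/-- ★ **`Dlog(e^{uX})[e^{uX}·X] = X` FOR `u` NEAR `0`** — differentiate `v ↦ log(e^{vX}) = vX` at `v = u` (chain rule through the analytic `log` at `e^{uX}`, `(e^{vX})′ = e^{vX}X`).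
[cite: Balaban1985Averaging, (21) p.21] -/
theorem eventually_fderiv_mlog_exp_smul_apply (X : 𝔸) :
    ∀ᶠ u : ℂ in 𝓝 0, fderiv ℂ (mlog : 𝔸 → 𝔸) (exp (u • X)) (exp (u • X) * X) = X := by
  filter_upwards [(eventually_mlog_exp_smul X).eventually_nhds, eventually_norm_exp_smul_sub_one_lt X] with u hu1 hu2
  have hγ : HasDerivAt (fun v : ℂ => exp (v • X)) (exp (u • X) * X) u := hasDerivAt_exp_smul_const (𝕂 := ℂ) X u
  have hm : HasFDerivAt (mlog : 𝔸 → 𝔸) (fderiv ℂ (mlog : 𝔸 → 𝔸) (exp (u • X))) (exp (u • X)) :=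
    (analyticAt_mlog hu2).differentiableAt.hasFDerivAt
  have hcomp := hm.comp_hasDerivAt u hγ
  have hlin : HasDerivAt (fun v : ℂ => v • X) X u := by
    simpa using (hasDerivAt_id u).smul_const X
  have hev : (fun v : ℂ => v • X) =ᶠ[𝓝 u] ((mlog : 𝔸 → 𝔸) ∘ fun v : ℂ => exp (v • X)) :=
    hu1.mono fun v hv => hv.symm
  exact (hcomp.congr_of_eventuallyEq hev).unique hlin

/-! ## §2 The second derivative at the identity -/

/-- ★ **THE DIAGONAL `D²log(1)[X, X] = −X²`**: differentiate §1's `u ↦ Dlog(e^{uX})[e^{uX}X] = X` at `u = 0` by `HasDerivAt.clm_apply` (`D(Dlog)(1)` exists: `log` is analytic at `1`).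
[cite: Balaban1985Averaging, (21) p.21] -/
theorem fderiv_fderiv_mlog_one_apply_self_add (X : 𝔸) :
    fderiv ℂ (fderiv ℂ (mlog : 𝔸 → 𝔸)) 1 X X + X * X = 0 := by
  have han : AnalyticAt ℂ (mlog : 𝔸 → 𝔸) 1 := analyticAt_mlog (by simp)
  have hγ : HasDerivAt (fun u : ℂ => exp (u • X)) X 0 := by
    simpa using hasDerivAt_exp_smul_const (𝕂 := ℂ) X (0 : ℂ)
  have hγ0 : exp ((0 : ℂ) • X) = (1 : 𝔸) := by rw [zero_smul, exp_zero]
  have hd2 : HasFDerivAt (fderiv ℂ (mlog : 𝔸 → 𝔸)) (fderiv ℂ (fderiv ℂ (mlog : 𝔸 → 𝔸)) 1) (exp ((0 : ℂ) • X)) := by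
    rw [hγ0]; exact han.fderiv.differentiableAt.hasFDerivAt
  have hc : HasDerivAt (fun u : ℂ => fderiv ℂ (mlog : 𝔸 → 𝔸) (exp (u • X))) (fderiv ℂ (fderiv ℂ (mlog : 𝔸 → 𝔸)) 1 X) 0 := by
    have h := hd2.comp_hasDerivAt (0 : ℂ) hγ
    simpa only [Function.comp_def] using h
  have hu : HasDerivAt (fun u : ℂ => exp (u • X) * X) (X * X) 0 := by
    simpa using hγ.mul_const X
  have hφ := hc.clm_apply hu
  have hconst : HasDerivAt (fun u : ℂ => fderiv ℂ (mlog : 𝔸 → 𝔸) (exp (u • X)) (exp (u • X) * X)) 0 0 := by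
    refine (hasDerivAt_const (0 : ℂ) X).congr_of_eventuallyEq ?_
    exact eventually_fderiv_mlog_exp_smul_apply X
  have h := hφ.unique hconst
  rw [zero_smul, exp_zero, one_mul, fderiv_mlog_one, one_apply_eq_self] at h
  exact h

/-- ★★★ **`D²log(1)[X, W] = −½(XW + WX)`** — the diagonal (★`fderiv_fderiv_mlog_one_apply_self_add`) polarized with the symmetry of the second derivative of an analytic function
(`ContDiffAt.isSymmSndFDerivAt_of_omega`). [cite: Balaban1985Averaging, (21) p.21] -/
theorem fderiv_fderiv_mlog_one_apply (X W : 𝔸) :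
    fderiv ℂ (fderiv ℂ (mlog : 𝔸 → 𝔸)) 1 X W = -((2 : ℂ)⁻¹ • (X * W + W * X)) := by
  have han : AnalyticAt ℂ (mlog : 𝔸 → 𝔸) 1 := analyticAt_mlog (by simp)
  set B₀ := fderiv ℂ (fderiv ℂ (mlog : 𝔸 → 𝔸)) 1 with hB₀
  have hsymm : B₀ W X = B₀ X W := (han.contDiffAt.isSymmSndFDerivAt_of_omega) W X
  have hS := eq_neg_of_add_eq_zero_left (fderiv_fderiv_mlog_one_apply_self_add (X + W))
  have hXX := eq_neg_of_add_eq_zero_left (fderiv_fderiv_mlog_one_apply_self_add X)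
  have hWW := eq_neg_of_add_eq_zero_left (fderiv_fderiv_mlog_one_apply_self_add W)
  have hexp : B₀ (X + W) (X + W) = B₀ X X + B₀ X W + B₀ W X + B₀ W W := by
    simp only [map_add, add_apply]; abel
  rw [← hB₀] at hXX hWW
  rw [← hB₀, hexp, hXX, hWW, hsymm] at hS
  set m := B₀ X W with hm
  have h2 : m + m = -(X * W + W * X) := by
    have e : m + m = -(X * X) + m + m + -(W * W) + X * X + W * W := by abel
    rw [hS] at e
    rw [e]; noncomm_ring
  have h3 : (2 : ℂ) • m = -(X * W + W * X) := by rw [two_smul, h2]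
  calc m = (2 : ℂ)⁻¹ • ((2 : ℂ) • m) := by rw [inv_smul_smul₀ two_ne_zero]
    _ = -((2 : ℂ)⁻¹ • (X * W + W * X)) := by rw [h3, smul_neg]

omit [CompleteSpace 𝔸] in
/-- The bilinear letter applied: `(−½(mul + mul.flip)) X W = −½(XW + WX)`. [folklore] -/
theorem sndDeriv_apply (X W : 𝔸) :
    (-((2 : ℂ)⁻¹ • (ContinuousLinearMap.mul ℂ 𝔸 + (ContinuousLinearMap.mul ℂ 𝔸).flip))) X W = -((2 : ℂ)⁻¹ • (X * W + W * X)) := by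
  rw [neg_apply, neg_apply, smul_apply, smul_apply, add_apply, add_apply, ContinuousLinearMap.mul_apply', ContinuousLinearMap.flip_apply, ContinuousLinearMap.mul_apply']

/-- ★★★ **`HasFDerivAt (Dlog) (−½(mul + mul.flip)) 1`** — the second Fréchet derivative of `log` at the identity as a continuous bilinear map: `X ↦ (W ↦ −½(XW + WX))`.
[cite: Balaban1985Averaging, (21) p.21] -/
theorem hasFDerivAt_fderiv_mlog_one :
    HasFDerivAt (fderiv ℂ (mlog : 𝔸 → 𝔸)) (-((2 : ℂ)⁻¹ • (ContinuousLinearMap.mul ℂ 𝔸 + (ContinuousLinearMap.mul ℂ 𝔸).flip))) 1 := by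
  have han : AnalyticAt ℂ (mlog : 𝔸 → 𝔸) 1 := analyticAt_mlog (by simp)
  have hd2 : HasFDerivAt (fderiv ℂ (mlog : 𝔸 → 𝔸)) (fderiv ℂ (fderiv ℂ (mlog : 𝔸 → 𝔸)) 1) 1 := han.fderiv.differentiableAt.hasFDerivAt
  have heq : fderiv ℂ (fderiv ℂ (mlog : 𝔸 → 𝔸)) 1 = -((2 : ℂ)⁻¹ • (ContinuousLinearMap.mul ℂ 𝔸 + (ContinuousLinearMap.mul ℂ 𝔸).flip)) := by
    ext X W
    rw [fderiv_fderiv_mlog_one_apply, sndDeriv_apply]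
  rw [← heq]; exact hd2

/-! ## §3 Readings along curves through `1` (complex parameter) -/

/-- ★ **ALONG A CURVE THROUGH `1`**: `γ u₀ = 1`, `γ′(u₀) = X` ⟹ `d∕du|_{u₀} Dlog(γ u) = −½(mul X + mul.flip X)`. [cite: Balaban1985Averaging, (21) p.21] -/
theorem hasDerivAt_fderiv_mlog_comp {γ : ℂ → 𝔸} {X : 𝔸} {u₀ : ℂ} (hγ0 : γ u₀ = 1) (hγ : HasDerivAt γ X u₀) :
    HasDerivAt (fun u : ℂ => fderiv ℂ (mlog : 𝔸 → 𝔸) (γ u)) ((-((2 : ℂ)⁻¹ • (ContinuousLinearMap.mul ℂ 𝔸 + (ContinuousLinearMap.mul ℂ 𝔸).flip))) X) u₀ := by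
  have hB : HasFDerivAt (fderiv ℂ (mlog : 𝔸 → 𝔸)) (-((2 : ℂ)⁻¹ • (ContinuousLinearMap.mul ℂ 𝔸 + (ContinuousLinearMap.mul ℂ 𝔸).flip))) (γ u₀) := by
    rw [hγ0]; exact hasFDerivAt_fderiv_mlog_one
  have h := hB.comp_hasDerivAt u₀ hγ
  simpa only [Function.comp_def] using h

/-- ★★ **THE SECOND-ORDER READING ALONG A CURVE, APPLIED**: for `γ u₀ = 1`, `γ′(u₀) = X` and a vector curve `w` with `w′(u₀) = w′`,
`d∕du|_{u₀} Dlog(γ u)[w u] = −½(X·w(u₀) + w(u₀)·X) + w′` (using `Dlog(γ u₀) = Dlog(1) = 1`). [cite: Balaban1985Averaging, (21) p.21] -/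
theorem hasDerivAt_fderiv_mlog_comp_apply {γ : ℂ → 𝔸} {X : 𝔸} {u₀ : ℂ} (hγ0 : γ u₀ = 1) (hγ : HasDerivAt γ X u₀)
    {w : ℂ → 𝔸} {w' : 𝔸} (hw : HasDerivAt w w' u₀) :
    HasDerivAt (fun u : ℂ => fderiv ℂ (mlog : 𝔸 → 𝔸) (γ u) (w u)) (-((2 : ℂ)⁻¹ • (X * w u₀ + w u₀ * X)) + w') u₀ := by
  have h := (hasDerivAt_fderiv_mlog_comp hγ0 hγ).clm_apply hw
  rw [sndDeriv_apply, hγ0, fderiv_mlog_one, one_apply_eq_self] at h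
  exact h

end Summit.QuantumFields.YangMills.Theorems.Prop7MlogSecondDerivative

end
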